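import Mathlib
import Summits.ValiantsHypothesis.ValiantsHypothesis.Theorems.LacunarySymmetroidMatrixDescartesInertiaJumpMixed
import Summits.ValiantsHypothesis.ValiantsHypothesis.Theorems.LacunarySymmetroidMatrixDescartesInertiaIndexFormula

/-!
# `MatrixDescartes` (stmt-ValiantsHypothesis-18050) — INERTIA KIT, IV-j: THE INDEX FORMULA WITH MIXED-TYPE ROOTS — on a window whose
# roots all have NON-DEGENERATE kernel forms of signatures `(p_t, q_t)`: `ν(F(b)) + Σ q_t = ν(F(a)) + Σ p_t`, `π` mirrors, and
# `Σ (p_t + q_t)` is the number of roots counted with multiplicity; every symmetric lacunary pencil, every format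

HONEST FRAMING.  Cell `pub-symmetroid`, seat `val-sym-mdr-p2` (gen 17); helper file `--supports` the crux
`Theses.LacunarySymmetroid.MatrixDescartes`, NO closure claim.  The bookkeeping wrapper announced in `…InertiaIndexFormula` (definite
types only) for the general semisimple case: the pieces are the mixed-type jump / multiplicity laws of `…InertiaJumpMixed` and the index
telescope of `…InertiaIndexTelescope`.  Nothing here bears on the crux in its window, on `stub_twoSided`, on `DoorA26`/`DoorA34`,
registers, or `VP ≠ VNP`.

CONTENT.  `index_formula_mixed`: `F(X) = ∑ₖ X^{dₖ}Sₖ` real symmetric, `a < b` non-singular scales, and at every root `t ∈ (a, b)` splitting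
kernel families `n⁻_t` (`p t` vectors, kernel form negative) and `n⁺_t` (`q t` vectors, kernel form positive) with `p t + q t = dim ker F(t)`.
Then, summing over the distinct roots `t` of `det F` in `(a, b)`: `ν(F(b)) + Σ q_t = ν(F(a)) + Σ p_t`, `π(F(b)) + Σ p_t = π(F(a)) + Σ q_t`,
and `Σ (p_t + q_t) = #{roots in (a, b) counted with multiplicity}`.  Hence `#roots = |ν(F(b)) − ν(F(a))| + 2·Σ min-side`: a root of
signature `(p, q)` contributes `p + q` to the count and only `p − q` to the inertia drift. [folklore]; axioms standard; no definitions.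
-/

-- layout Summits/ValiantsHypothesis/ValiantsHypothesis forces the duplicated namespace component
set_option linter.dupNamespace false

namespace Summit.ValiantsHypothesis.ValiantsHypothesis.Theorems.LacunarySymmetroidMatrixDescartes

open Matrix Finset Polynomial
open scoped BigOperators Topology

namespace Inertia

variable {ι : Type} [Fintype ι] [DecidableEq ι]

section Pencil

variable {κ : Type} [Fintype κ]

/-- **THE INDEX FORMULA WITH MIXED-TYPE ROOTS.** [folklore] -/
theorem index_formula_mixed (d : κ → ℕ) (S : κ → Matrix ι ι ℝ) (hS : ∀ k, (S k).IsSymm)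
    {a b : ℝ} (hab : a < b) (ha : (∑ k, a ^ d k • S k).det ≠ 0) (hb : (∑ k, b ^ d k • S k).det ≠ 0)
    (p q : ℝ → ℕ)
    (hsplit : ∀ t, a < t → t < b → (∑ k, t ^ d k • S k).det = 0 →
      ∃ (nm : Fin (p t) → ι → ℝ) (np : Fin (q t) → ι → ℝ),
        (∀ j, (∑ k, t ^ d k • S k) *ᵥ nm j = 0) ∧ (∀ j, (∑ k, t ^ d k • S k) *ᵥ np j = 0) ∧
        (∀ c : Fin (p t) → ℝ, c ≠ 0 →
          (∑ j, c j • nm j) ⬝ᵥ ((∑ k, ((d k : ℝ) * t ^ (d k - 1)) • S k) *ᵥ ∑ j, c j • nm j) < 0) ∧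
        (∀ c : Fin (q t) → ℝ, c ≠ 0 →
          0 < (∑ j, c j • np j) ⬝ᵥ ((∑ k, ((d k : ℝ) * t ^ (d k - 1)) • S k) *ᵥ ∑ j, c j • np j)) ∧
        p t + q t = Fintype.card ι - (∑ k, t ^ d k • S k).rank) :
    Fintype.card {j // (isHermitian_pencil d S hS b).eigenvalues j < 0}
        + ∑ t ∈ (Matrix.det (∑ k, ((X : ℝ[X]) ^ d k) • (S k).map C)).roots.toFinset.filter (fun t => a < t ∧ t < b), q t
      = Fintype.card {j // (isHermitian_pencil d S hS a).eigenvalues j < 0}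
        + ∑ t ∈ (Matrix.det (∑ k, ((X : ℝ[X]) ^ d k) • (S k).map C)).roots.toFinset.filter (fun t => a < t ∧ t < b), p t ∧
    Fintype.card {j // 0 < (isHermitian_pencil d S hS b).eigenvalues j}
        + ∑ t ∈ (Matrix.det (∑ k, ((X : ℝ[X]) ^ d k) • (S k).map C)).roots.toFinset.filter (fun t => a < t ∧ t < b), p t
      = Fintype.card {j // 0 < (isHermitian_pencil d S hS a).eigenvalues j}
        + ∑ t ∈ (Matrix.det (∑ k, ((X : ℝ[X]) ^ d k) • (S k).map C)).roots.toFinset.filter (fun t => a < t ∧ t < b), q t ∧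
    ∑ t ∈ (Matrix.det (∑ k, ((X : ℝ[X]) ^ d k) • (S k).map C)).roots.toFinset.filter (fun t => a < t ∧ t < b), (p t + q t)
      = Multiset.card ((Matrix.det (∑ k, ((X : ℝ[X]) ^ d k) • (S k).map C)).roots.filter (fun t => a < t ∧ t < b)) := by
  classical
  set P := Matrix.det (∑ k, ((X : ℝ[X]) ^ d k) • (S k).map C) with hP
  have hdet : P ≠ 0 := det_pencil_ne_zero_of_eval d S ha
  set T := P.roots.toFinset with hT
  have hTmem : ∀ x ∈ Set.Icc a b, (∑ k, x ^ d k • S k).det = 0 → x ∈ T :=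
    fun x _ hx => mem_rootSet_of_det_eq_zero d S hdet hx
  have hroot : ∀ t ∈ T, (∑ k, t ^ d k • S k).det = 0 := fun t ht => DefiniteMoments.det_eval_eq_zero_of_mem d S ht
  -- the one-sided jump hypotheses from the splitting families
  have hjumps : ∀ t ∈ T, a < t → t < b →
      (∀ᶠ x in 𝓝[>] t,
        Fintype.card {j // (isHermitian_pencil d S hS x).eigenvalues j < 0}
          = Fintype.card {j // (isHermitian_pencil d S hS t).eigenvalues j < 0} + p t ∧
        Fintype.card {j // 0 < (isHermitian_pencil d S hS x).eigenvalues j}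
          = Fintype.card {j // 0 < (isHermitian_pencil d S hS t).eigenvalues j} + q t ∧
        Fintype.card ι - (∑ k, x ^ d k • S k).rank = 0) ∧
      (∀ᶠ x in 𝓝[<] t,
        Fintype.card {j // (isHermitian_pencil d S hS x).eigenvalues j < 0}
          = Fintype.card {j // (isHermitian_pencil d S hS t).eigenvalues j < 0} + q t ∧
        Fintype.card {j // 0 < (isHermitian_pencil d S hS x).eigenvalues j}
          = Fintype.card {j // 0 < (isHermitian_pencil d S hS t).eigenvalues j} + p t ∧
        Fintype.card ι - (∑ k, x ^ d k • S k).rank = 0) ∧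
      P.rootMultiplicity t = p t + q t := by
    intro t ht h1 h2
    obtain ⟨nm, np, hnm0, hnp0, hnm, hnp, hcard⟩ := hsplit t h1 h2 (hroot t ht)
    have hcard' : Fintype.card (Fin (p t)) + Fintype.card (Fin (q t)) = Fintype.card ι - (∑ k, t ^ d k • S k).rank := by
      rw [Fintype.card_fin, Fintype.card_fin]; exact hcard
    refine ⟨?_, ?_, ?_⟩
    · have h := pencil_indices_eq_right d S hS t nm np hnm0 hnp0 hnm hnp hcard'
      simp only [Fintype.card_fin] at h
      exact h
    · have h := pencil_indices_eq_left d S hS t nm np hnm0 hnp0 hnm hnp hcard'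
      simp only [Fintype.card_fin] at h
      exact h
    · have h := (pencil_rootMultiplicity_eq_of_split d S hS t nm np hnm0 hnp0 hnm hnp hcard').2
      rw [Fintype.card_fin, Fintype.card_fin] at h
      exact h
  have hν := negIndex_telescope (fun x => ∑ k, x ^ d k • S k) (continuous_pencil_entry d S) (isHermitian_pencil d S hS)
    T p q hab hTmem ha hb
    (fun t ht h1 h2 => ((hjumps t ht h1 h2).1).mono fun x hx => hx.1)
    (fun t ht h1 h2 => ((hjumps t ht h1 h2).2.1).mono fun x hx => hx.1)
  have hπ := posIndex_telescope (fun x => ∑ k, x ^ d k • S k) (continuous_pencil_entry d S) (isHermitian_pencil d S hS)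
    T q p hab hTmem ha hb
    (fun t ht h1 h2 => ((hjumps t ht h1 h2).1).mono fun x hx => hx.2.1)
    (fun t ht h1 h2 => ((hjumps t ht h1 h2).2.1).mono fun x hx => hx.2.1)
  refine ⟨hν, hπ, ?_⟩
  -- multiplicity currency
  calc ∑ t ∈ T.filter (fun t => a < t ∧ t < b), (p t + q t)
      = ∑ t ∈ T.filter (fun t => a < t ∧ t < b), P.rootMultiplicity t :=
        Finset.sum_congr rfl fun t ht => by
          obtain ⟨htT, h1, h2⟩ := Finset.mem_filter.1 ht
          exact ((hjumps t htT h1 h2).2.2).symm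
    _ = ∑ t ∈ (P.roots.filter (fun t => a < t ∧ t < b)).toFinset, (P.roots.filter (fun t => a < t ∧ t < b)).count t := by
        rw [hT, Multiset.toFinset_filter]
        refine Finset.sum_congr rfl fun t ht => ?_
        rw [Multiset.count_filter_of_pos (p := fun t => a < t ∧ t < b) (Finset.mem_filter.1 ht).2, count_roots]
    _ = Multiset.card (P.roots.filter (fun t => a < t ∧ t < b)) := Multiset.toFinset_sum_count_eq _

end Pencil

end Inertia

end Summit.ValiantsHypothesis.ValiantsHypothesis.Theorems.LacunarySymmetroidMatrixDescartes
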